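import Mathlib.Geometry.Manifold.PartitionOfUnity
import Mathlib.Geometry.Manifold.MFDeriv.Atlas
import Mathlib.Analysis.Normed.Module.HahnBanach
import Mathlib.Analysis.Calculus.Deriv.Inverse
import Mathlib.Algebra.Order.ToIntervalMod
import Literature.Analysis.Calculus.LocalInverseOnCompact
import HarnessLib

/-!
# Extending a periodic function along an embedded loop to a smooth function on the manifold

Topic `Literature/Geometry/Manifold` (namespace `Literature.Geometry.Manifold`); proofs only, no
definition and no named fact (D-0026).  The elementary extension statement

* `exists_contMDiff_loop_extension` — let `γ : ℝ → M` be a `C^∞` loop of period `T > 0` in a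
  compact Hausdorff manifold `M` (finite-dimensional real model), injective on `[0, T)` and
  immersed (`dγ/dt ≠ 0`), and let `f : ℝ → ℝ` be `C^∞` and `T`-periodic.  Then for every open
  `U ⊇ γ(ℝ)` there is a `C^∞` function `F : M → ℝ` with `F (γ t) = f t` for all `t` and
  `tsupport F ⊆ U`;
* `mfderiv_comp_loop_apply` — consequently `dF_{γ(t)}(γ̇(t)) = f'(t)`.

This is the order-zero case of the fact that smooth functions on a closed embedded submanifold
extend (Lee, *Introduction to Smooth Manifolds*, 2nd ed., Lemma 5.34 (extension lemma for
functions on submanifolds), proved there, as here, from local slice coordinates and a partition of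
unity, Thm. 2.23).  The proof avoids slice charts: near `γ(t₀)` one coordinate `ℓ ∘ φ` of the
chart `φ` at `γ(t₀)` (`ℓ` a linear functional with `ℓ(dφ(γ̇(t₀))) ≠ 0`, Hahn–Banach) restricts to
a local diffeomorphism `s = ℓ ∘ φ ∘ γ` of the parameter line (inverse function theorem, in the
tree's form `Literature.Analysis.Calculus.exists_openPartialHomeomorph_contDiffOn_symm`), and
`f ∘ s⁻¹ ∘ ℓ ∘ φ` is a local extension; injectivity of the loop makes the local identity
`F_loc (γ t) = f t` hold for ALL parameters `t` with `γ t` in a small neighbourhood of `γ(t₀)`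
(the image of the rest of a period is a compact set missing `γ(t₀)`); the local extensions are
glued by a smooth partition of unity (Mathlib `SmoothPartitionOfUnity.exists_isSubordinate`).

Consumer: the Legendrian realisation of a page curve through Giroux forms
(`Geometry/Symplectic/LegendrianRealisationOnPage.lean`), where the correction `dF` of a contact
form along a page curve `γ` is prescribed through `F ∘ γ`.

## References
* J. M. Lee, *Introduction to Smooth Manifolds*, 2nd ed., GTM 218 (2013), Lemma 5.34, Thm. 2.23.
  [LeeSmoothManifolds2013]
-/

noncomputable section

open scoped Manifold ContDiff Topology
open Set Function Filter

namespace Literature.Geometry.Manifold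

/-! ### Periodic injective loops -/

section Loop

variable {X : Type*} {γ : ℝ → X} {T : ℝ}

/-- A `T`-periodic map injective on `[0, T)` identifies exactly the parameters that differ by a
multiple of the period. [folklore] -/
theorem exists_zsmul_eq_sub_of_periodic_injOn (hT : 0 < T) (hper : Periodic γ T)
    (hinj : InjOn γ (Ico 0 T)) {a b : ℝ} (h : γ a = γ b) : ∃ n : ℤ, b - a = n • T := by
  have ha : γ (toIcoMod hT 0 a) = γ a := by
    rw [show toIcoMod hT 0 a = a - toIcoDiv hT 0 a • T from rfl]
    exact hper.sub_zsmul_eq _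
  have hb : γ (toIcoMod hT 0 b) = γ b := by
    rw [show toIcoMod hT 0 b = b - toIcoDiv hT 0 b • T from rfl]
    exact hper.sub_zsmul_eq _
  have hma : toIcoMod hT 0 a ∈ Ico 0 T := by simpa using toIcoMod_mem_Ico' hT a
  have hmb : toIcoMod hT 0 b ∈ Ico 0 T := by simpa using toIcoMod_mem_Ico' hT b
  have heq : toIcoMod hT 0 a = toIcoMod hT 0 b := hinj hma hmb (by rw [ha, hb, h])
  refine ⟨toIcoDiv hT 0 b - toIcoDiv hT 0 a, ?_⟩
  have ea := toIcoMod_add_toIcoDiv_zsmul hT 0 a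
  have eb := toIcoMod_add_toIcoDiv_zsmul hT 0 b
  rw [sub_zsmul]
  linarith

/-- Two parameters of an injective periodic loop with the same image and at distance at most half
a period are equal. [folklore] -/
theorem eq_of_periodic_injOn_of_abs_sub_le (hT : 0 < T) (hper : Periodic γ T)
    (hinj : InjOn γ (Ico 0 T)) {a b : ℝ} (h : γ a = γ b) (hab : |b - a| ≤ T / 2) : a = b := by
  obtain ⟨n, hn⟩ := exists_zsmul_eq_sub_of_periodic_injOn hT hper hinj h
  have h1 : |(n : ℝ)| * T ≤ T / 2 := by
    have : |b - a| = |(n : ℝ)| * T := by rw [hn, zsmul_eq_mul, abs_mul, abs_of_pos hT]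
    linarith [this ▸ hab]
  have h2 : |(n : ℝ)| < 1 := by
    by_contra hc
    push Not at hc
    nlinarith
  have hn0 : n = 0 := by
    have : |n| < 1 := by exact_mod_cast h2
    exact Int.abs_lt_one_iff.1 this
  rw [hn0, zero_zsmul, sub_eq_zero] at hn
  exact hn.symm

/-- The range of a periodic map is the image of one closed period. [folklore] -/
theorem range_eq_image_Icc_of_periodic (hT : 0 < T) (hper : Periodic γ T) :
    range γ = γ '' Icc 0 T := by
  refine Subset.antisymm ?_ (image_subset_range _ _)
  rintro _ ⟨t, rfl⟩
  refine ⟨toIcoMod hT 0 t, Ico_subset_Icc_self (by simpa using toIcoMod_mem_Ico' hT t), ?_⟩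
  rw [show toIcoMod hT 0 t = t - toIcoDiv hT 0 t • T from rfl]
  exact hper.sub_zsmul_eq _

/-- The range of a continuous periodic map is compact. [folklore] -/
theorem isCompact_range_of_periodic [TopologicalSpace X] (hT : 0 < T) (hper : Periodic γ T)
    (hc : Continuous γ) : IsCompact (range γ) := by
  rw [range_eq_image_Icc_of_periodic hT hper]
  exact isCompact_Icc.image hc

/-- **Localisation along an injective loop.**  If `γ` is continuous, `T`-periodic and injective
on `[0, T)`, and the open ball `B(t₀, δ)` of parameters is given, there is an open neighbourhood
`V` of `γ t₀` such that every parameter `t` with `γ t ∈ V` lies in `B(t₀, δ)` up to a multiple of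
the period. [folklore] -/
theorem exists_nhds_preimage_subset_of_periodic_injOn [TopologicalSpace X] [T2Space X]
    (hT : 0 < T) (hper : Periodic γ T) (hc : Continuous γ) (hinj : InjOn γ (Ico 0 T))
    (t₀ : ℝ) {δ : ℝ} (hδ : 0 < δ) :
    ∃ V : Set X, IsOpen V ∧ γ t₀ ∈ V ∧
      ∀ t, γ t ∈ V → ∃ n : ℤ, t - n • T ∈ Metric.ball t₀ δ := by
  set C : Set X := γ '' (Icc (t₀ - T / 2) (t₀ + T / 2) \ Metric.ball t₀ δ) with hC
  have hCc : IsCompact C := (isCompact_Icc.diff Metric.isOpen_ball).image hc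
  have ht₀ : γ t₀ ∉ C := by
    rintro ⟨t', ⟨ht'I, ht'B⟩, ht'⟩
    have hle : |t' - t₀| ≤ T / 2 := abs_sub_le_iff.2 ⟨by linarith [ht'I.2], by linarith [ht'I.1]⟩
    have := eq_of_periodic_injOn_of_abs_sub_le hT hper hinj ht'.symm hle
    subst this
    exact ht'B (Metric.mem_ball_self hδ)
  refine ⟨Cᶜ, hCc.isClosed.isOpen_compl, ht₀, fun t ht => ?_⟩
  -- reduce `t` to the window `[t₀ - T/2, t₀ + T/2)`
  refine ⟨toIcoDiv hT (t₀ - T / 2) t, ?_⟩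
  set r := toIcoMod hT (t₀ - T / 2) t with hr
  have hr_eq : r = t - toIcoDiv hT (t₀ - T / 2) t • T := rfl
  have hrI : r ∈ Ico (t₀ - T / 2) (t₀ - T / 2 + T) := toIcoMod_mem_Ico hT (t₀ - T / 2) t
  have hγr : γ r = γ t := by rw [hr_eq]; exact hper.sub_zsmul_eq _
  rw [← hr_eq]
  by_contra hrB
  apply ht
  refine ⟨r, ⟨⟨hrI.1, by linarith [hrI.2]⟩, hrB⟩, hγr⟩

end Loop

/-! ### Curves into a manifold: the velocity read in a chart -/

section Velocity

variable {E : Type*} [NormedAddCommGroup E] [NormedSpace ℝ E]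
  {H : Type*} [TopologicalSpace H] {I : ModelWithCorners ℝ E H}
  {M : Type*} [TopologicalSpace M] [ChartedSpace H M]

/-- For a curve `γ : ℝ → M`, the chart expression at `t₀` is `extChartAt I (γ t₀) ∘ γ`.
[folklore] -/
theorem writtenInExtChartAt_curve (γ : ℝ → M) (t₀ : ℝ) :
    writtenInExtChartAt 𝓘(ℝ, ℝ) I t₀ γ = extChartAt I (γ t₀) ∘ γ := by
  funext t
  simp [writtenInExtChartAt]

/-- **The velocity of a differentiable curve in the chart at the point**: `dγ_{t₀}(1)` (an
element of `T_{γ t₀} M = E`) is the derivative at `t₀` of `extChartAt I (γ t₀) ∘ γ`.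
[folklore] -/
theorem mfderiv_curve_apply_one {γ : ℝ → M} {t₀ : ℝ} (hγ : MDifferentiableAt 𝓘(ℝ, ℝ) I γ t₀) :
    mfderiv 𝓘(ℝ, ℝ) I γ t₀ (1 : ℝ) = deriv (extChartAt I (γ t₀) ∘ γ) t₀ := by
  rw [hγ.mfderiv, writtenInExtChartAt_curve, ← fderiv_apply_one_eq_deriv]
  simp only [extChartAt_model_space_eq_id, PartialEquiv.refl_coe,
    modelWithCornersSelf_coe, range_id, fderivWithin_univ]
  rfl

variable [IsManifold I ∞ M]

/-- The chart expression `extChartAt I (γ t₀) ∘ γ` of a `C^∞` curve is `C^∞` at every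
parameter whose image lies in the chart domain. [folklore] -/
theorem contDiffAt_extChartAt_comp_curve {γ : ℝ → M} (hγ : ContMDiff 𝓘(ℝ, ℝ) I ∞ γ) {t₀ t : ℝ}
    (ht : γ t ∈ (chartAt H (γ t₀)).source) :
    ContDiffAt ℝ ∞ (extChartAt I (γ t₀) ∘ γ) t := by
  have h1 : ContMDiffAt I 𝓘(ℝ, E) ∞ (extChartAt I (γ t₀)) (γ t) := contMDiffAt_extChartAt' ht
  have h2 : ContMDiffAt 𝓘(ℝ, ℝ) 𝓘(ℝ, E) ∞ (extChartAt I (γ t₀) ∘ γ) t := h1.comp t (hγ t)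
  exact contMDiffAt_iff_contDiffAt.1 h2

/-- The chart expression of a `C^∞` curve is differentiable at the centre parameter, with
derivative the velocity. [folklore] -/
theorem hasDerivAt_extChartAt_comp_curve {γ : ℝ → M} (hγ : ContMDiff 𝓘(ℝ, ℝ) I ∞ γ) (t₀ : ℝ) :
    HasDerivAt (extChartAt I (γ t₀) ∘ γ) (mfderiv 𝓘(ℝ, ℝ) I γ t₀ (1 : ℝ)) t₀ := by
  rw [mfderiv_curve_apply_one ((hγ t₀).mdifferentiableAt (by simp))]
  exact ((contDiffAt_extChartAt_comp_curve hγ (mem_chart_source H (γ t₀))).differentiableAt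
    (by simp)).hasDerivAt

end Velocity

/-! ### The local extension near one point of the loop -/

section Local

variable {E : Type*} [NormedAddCommGroup E] [NormedSpace ℝ E]
  {H : Type*} [TopologicalSpace H] {I : ModelWithCorners ℝ E H}
  {M : Type*} [TopologicalSpace M] [ChartedSpace H M] [IsManifold I ∞ M]

/-- **Local extension along an immersed curve.**  Near `γ t₀` (`γ` a `C^∞` curve with
`γ̇(t₀) ≠ 0`) there are an open set `V₀ ∋ γ t₀`, a function `G : M → ℝ` which is `C^∞` on `V₀`,
and `δ > 0` such that `γ t ∈ V₀` and `G (γ t) = f t` for `|t - t₀| < δ`: one takes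
`G = f ∘ s⁻¹ ∘ ℓ ∘ φ` with `φ` the chart at `γ t₀`, `ℓ` a linear functional not vanishing on
`dφ(γ̇(t₀))` and `s⁻¹` the local inverse of `s = ℓ ∘ φ ∘ γ`. [cite: LeeSmoothManifolds2013, Lemma 5.34] -/
theorem exists_local_loop_extension {γ : ℝ → M} (hγ : ContMDiff 𝓘(ℝ, ℝ) I ∞ γ) (t₀ : ℝ)
    (himm : mfderiv 𝓘(ℝ, ℝ) I γ t₀ (1 : ℝ) ≠ 0) {f : ℝ → ℝ} (hf : ContDiff ℝ ∞ f) :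
    ∃ (V₀ : Set M) (G : M → ℝ) (δ : ℝ), IsOpen V₀ ∧ γ t₀ ∈ V₀ ∧ ContMDiffOn I 𝓘(ℝ, ℝ) ∞ G V₀ ∧
      0 < δ ∧ ∀ t, dist t t₀ < δ → γ t ∈ V₀ ∧ G (γ t) = f t := by
  set φ := extChartAt I (γ t₀) with hφ
  set v : E := mfderiv 𝓘(ℝ, ℝ) I γ t₀ (1 : ℝ) with hv
  -- a linear functional detecting the velocity
  have hv0 : v ≠ 0 := himm
  obtain ⟨ℓ, -, hℓv⟩ := exists_dual_vector ℝ v (norm_ne_zero_iff.2 hv0)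
  have hℓ : ℓ v ≠ 0 := by
    rw [hℓv]
    exact_mod_cast norm_ne_zero_iff.2 hv0
  -- the coordinate `s = ℓ ∘ φ ∘ γ` of the curve
  set s : ℝ → ℝ := fun t => ℓ (φ (γ t)) with hs
  set J₀ : Set ℝ := γ ⁻¹' (chartAt H (γ t₀)).source with hJ₀
  have hJ₀o : IsOpen J₀ := (chartAt H (γ t₀)).open_source.preimage hγ.continuous
  have ht₀J₀ : t₀ ∈ J₀ := mem_chart_source H (γ t₀)
  have hsC : ∀ t ∈ J₀, ContDiffAt ℝ ∞ s t := fun t ht =>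
    (ℓ.contDiff.contDiffAt).comp t (contDiffAt_extChartAt_comp_curve hγ ht)
  have hsO : ContDiffOn ℝ ∞ s J₀ := fun t ht => (hsC t ht).contDiffWithinAt
  have hs₀ : HasDerivAt s (ℓ v) t₀ := by
    have h := hasDerivAt_extChartAt_comp_curve hγ t₀
    exact (ℓ.hasFDerivAt.comp_hasDerivAt t₀ h)
  -- the open set where `s' ≠ 0`
  have hds : ContinuousOn (deriv s) J₀ := hsO.continuousOn_deriv_of_isOpen hJ₀o (by simp)
  set J : Set ℝ := J₀ ∩ deriv s ⁻¹' {0}ᶜ with hJ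
  have hJo : IsOpen J := hds.isOpen_inter_preimage hJ₀o isOpen_compl_singleton
  have ht₀J : t₀ ∈ J := ⟨ht₀J₀, by rw [mem_preimage, hs₀.deriv]; exact hℓ⟩
  have hJsub : J ⊆ J₀ := inter_subset_left
  -- the local inverse of `s` on `J`
  obtain ⟨e, hes, ht₀e, heJ, hesymm⟩ :=
    Literature.Analysis.Calculus.exists_openPartialHomeomorph_contDiffOn_symm (𝕂 := ℝ)
      (n := ∞) (f := s) (U := J) (K := {t₀}) (by simp) hJo (singleton_subset_iff.2 ht₀J)
      isCompact_singleton (hsO.mono hJsub)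
      (fun t ht => by
        have hd : HasDerivAt s (deriv s t) t :=
          ((hsC t (hJsub ht)).differentiableAt (by simp)).hasDerivAt
        exact ⟨_, hd.hasFDerivAt_equiv ht.2⟩)
      (subsingleton_singleton.injOn _)
  have ht₀e' : t₀ ∈ e.source := ht₀e (mem_singleton _)
  -- the local extension and its domain
  set V₀ : Set M := (chartAt H (γ t₀)).source ∩ φ ⁻¹' (ℓ ⁻¹' e.target) with hV₀
  have hV₀o : IsOpen V₀ := by
    exact isOpen_extChartAt_preimage (I := I) (γ t₀) (e.open_target.preimage ℓ.continuous)
  set G : M → ℝ := fun x => f (e.symm (ℓ (φ x))) with hG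
  have hGV : ContMDiffOn I 𝓘(ℝ, ℝ) ∞ G V₀ := by
    have h1 : ContMDiffOn I 𝓘(ℝ, E) ∞ φ (chartAt H (γ t₀)).source := contMDiffOn_extChartAt
    have h2 : ContMDiffOn I 𝓘(ℝ, ℝ) ∞ (fun x => ℓ (φ x)) V₀ :=
      (ℓ.contDiff.contMDiff.comp_contMDiffOn (h1.mono inter_subset_left))
    have h3 : ContMDiffOn 𝓘(ℝ, ℝ) 𝓘(ℝ, ℝ) ∞ (fun y => f (e.symm y)) e.target :=
      (hf.comp_contDiffOn hesymm).contMDiffOn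
    refine (h3.comp h2 fun x hx => hx.2)
  obtain ⟨δ, hδ, hball⟩ := Metric.isOpen_iff.1 e.open_source t₀ ht₀e'
  refine ⟨V₀, G, δ, hV₀o, ?_, hGV, hδ, fun t ht => ?_⟩
  · refine ⟨mem_chart_source H (γ t₀), ?_⟩
    show ℓ (φ (γ t₀)) ∈ e.target
    rw [show ℓ (φ (γ t₀)) = e t₀ from by rw [hes]]
    exact e.map_source ht₀e'
  · have hte : t ∈ e.source := hball ht
    have htJ₀ : t ∈ J₀ := hJsub (heJ hte)
    refine ⟨⟨htJ₀, ?_⟩, ?_⟩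
    · show ℓ (φ (γ t)) ∈ e.target
      rw [show ℓ (φ (γ t)) = e t from by rw [hes]]
      exact e.map_source hte
    · show f (e.symm (ℓ (φ (γ t)))) = f t
      rw [show ℓ (φ (γ t)) = e t from by rw [hes], e.left_inv hte]

end Local

/-! ### The global extension -/

section Global

variable {E : Type*} [NormedAddCommGroup E] [NormedSpace ℝ E] [FiniteDimensional ℝ E]
  {H : Type*} [TopologicalSpace H] {I : ModelWithCorners ℝ E H}
  {M : Type*} [TopologicalSpace M] [ChartedSpace H M] [IsManifold I ∞ M]
  [T2Space M] [CompactSpace M]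

/-- **Extension of a periodic function along an embedded loop** (Lee, Lemma 5.34 for the
closed embedded submanifold `γ(ℝ) ≅ S¹`, order zero): for a `C^∞` loop `γ` of period `T > 0`,
injective on `[0, T)` and immersed, a `C^∞` `T`-periodic `f : ℝ → ℝ`, and an open `U ⊇ γ(ℝ)`,
there is a `C^∞` function `F` on `M` with `F ∘ γ = f` and `tsupport F ⊆ U`.
[cite: LeeSmoothManifolds2013, Lemma 5.34] -/
theorem exists_contMDiff_loop_extension {γ : ℝ → M} {T : ℝ} (hT : 0 < T)
    (hγ : ContMDiff 𝓘(ℝ, ℝ) I ∞ γ) (hper : Periodic γ T) (hinj : InjOn γ (Ico 0 T))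
    (himm : ∀ t, mfderiv 𝓘(ℝ, ℝ) I γ t (1 : ℝ) ≠ 0) {f : ℝ → ℝ} (hf : ContDiff ℝ ∞ f)
    (hfper : Periodic f T) {U : Set M} (hU : IsOpen U) (hγU : ∀ t, γ t ∈ U) :
    ∃ F : M → ℝ, ContMDiff I 𝓘(ℝ, ℝ) ∞ F ∧ (∀ t, F (γ t) = f t) ∧ tsupport F ⊆ U := by
  classical
  have hc : Continuous γ := hγ.continuous
  have hKc : IsCompact (range γ) := isCompact_range_of_periodic hT hper hc
  have hKU : range γ ⊆ U := by rintro _ ⟨t, rfl⟩; exact hγU t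
  -- an intermediate open set `W` with `γ(ℝ) ⊆ W ⊆ closure W ⊆ U`
  obtain ⟨W, hWo, hKW, hWU⟩ := normal_exists_closure_subset hKc.isClosed hU hKU
  -- local data at each point of `M`
  have hloc : ∀ y : M, ∃ (V : Set M) (G : M → ℝ), IsOpen V ∧ y ∈ V ∧
      ContMDiffOn I 𝓘(ℝ, ℝ) ∞ G V ∧ (∀ t, γ t ∈ V → G (γ t) = f t) ∧ (V ⊆ W ∨ G = 0) := by
    intro y
    by_cases hy : y ∈ range γ
    · obtain ⟨t₀, rfl⟩ := hy
      obtain ⟨V₀, G, δ, hV₀o, hV₀, hG, hδ, hloc⟩ := exists_local_loop_extension hγ t₀ (himm t₀) hf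
      obtain ⟨V₁, hV₁o, hV₁, hV₁loc⟩ :=
        exists_nhds_preimage_subset_of_periodic_injOn hT hper hc hinj t₀ hδ
      refine ⟨V₀ ∩ V₁ ∩ W, G, (hV₀o.inter hV₁o).inter hWo, ⟨⟨hV₀, hV₁⟩, hKW ⟨t₀, rfl⟩⟩,
        hG.mono (inter_subset_left.trans inter_subset_left), fun t ht => ?_,
        Or.inl inter_subset_right⟩
      obtain ⟨n, hn⟩ := hV₁loc t ht.1.2
      have h1 := (hloc (t - n • T) hn).2
      rw [hper.sub_zsmul_eq, hfper.sub_zsmul_eq] at h1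
      exact h1
    · refine ⟨(range γ)ᶜ, 0, hKc.isClosed.isOpen_compl, hy, contMDiffOn_const,
        fun t ht => (ht ⟨t, rfl⟩).elim, Or.inr rfl⟩
  choose V G hVo hyV hG hGγ hVW using hloc
  -- a smooth partition of unity subordinate to the cover `V`
  obtain ⟨ρ, hρ⟩ := SmoothPartitionOfUnity.exists_isSubordinate I isClosed_univ V hVo
    (fun y _ => mem_iUnion.2 ⟨y, hyV y⟩)
  refine ⟨fun x => ∑ᶠ y, ρ y x • G y x, ?_, fun t => ?_, ?_⟩
  · refine ρ.contMDiff_finsum_smul fun y x hx => ?_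
    exact (hG y).contMDiffAt ((hVo y).mem_nhds (hρ y hx))
  · have h1 : ∀ y, ρ y (γ t) • G y (γ t) = ρ y (γ t) • f t := by
      intro y
      by_cases h0 : ρ y (γ t) = 0
      · rw [h0, zero_smul, zero_smul]
      · rw [hGγ y t (hρ y (subset_closure (mem_support.2 h0)))]
    simp_rw [h1]
    rw [← finsum_smul, ρ.sum_eq_one (mem_univ _), one_smul]
  · -- support: off `W` every summand vanishes
    refine (closure_mono fun x hx => ?_).trans hWU
    by_contra hxW
    apply hx
    refine finsum_eq_zero_of_forall_eq_zero fun y => ?_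
    rcases hVW y with h | h
    · have : ρ y x = 0 := by
        by_contra h0
        exact hxW (h (hρ y (subset_closure (mem_support.2 h0))))
      rw [this, zero_smul]
    · rw [h, Pi.zero_apply, smul_zero]

omit [FiniteDimensional ℝ E] [IsManifold I ∞ M] [T2Space M] [CompactSpace M] in
/-- **The differential of the extension along the loop**: if `F ∘ γ = f` then
`dF_{γ t}(γ̇ t) = f'(t)`. [folklore] -/
theorem mfderiv_comp_loop_apply {γ : ℝ → M} (hγ : ContMDiff 𝓘(ℝ, ℝ) I ∞ γ) {F : M → ℝ}
    (hF : ContMDiff I 𝓘(ℝ, ℝ) ∞ F) {f : ℝ → ℝ} (hFf : ∀ t, F (γ t) = f t) (t : ℝ) :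
    mfderiv I 𝓘(ℝ, ℝ) F (γ t) (mfderiv 𝓘(ℝ, ℝ) I γ t (1 : ℝ)) = deriv f t := by
  have hγd : MDifferentiableAt 𝓘(ℝ, ℝ) I γ t := (hγ t).mdifferentiableAt (by simp)
  have hFd : MDifferentiableAt I 𝓘(ℝ, ℝ) F (γ t) := (hF (γ t)).mdifferentiableAt (by simp)
  have hcomp : mfderiv 𝓘(ℝ, ℝ) 𝓘(ℝ, ℝ) (F ∘ γ) t = (mfderiv I 𝓘(ℝ, ℝ) F (γ t)).comp
      (mfderiv 𝓘(ℝ, ℝ) I γ t) := mfderiv_comp t hFd hγd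
  have hFγ : F ∘ γ = f := funext hFf
  rw [← ContinuousLinearMap.comp_apply, ← hcomp, hFγ, mfderiv_eq_fderiv]
  exact fderiv_apply_one_eq_deriv (𝕜 := ℝ) (f := f) (x := t)

end Global

end Literature.Geometry.Manifold
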